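import Summits.BirchSwinnertonDyer.BirchSwinnertonDyer.Theorems.ThetaPartnerAtTwoSignedMainConjectureCMTwoRankZeroKatoDescent
import Literature.NumberTheory.ComplexMultiplication.EllipticUnits.KatoEllipticZetaElement
import HarnessLib

/-!
# Kato's descent — file 4: the K-SIDE HALF of clause (g) on the typed elliptic-unit tower
# (`Kato2004.EllipticUnitTower`, Johnson-Leung–Kings Thm. 5.7 / §7.2 BY NAME), composed with the descent
# inequality

Helper file for crux K2R0P♭ `stmt-BirchSwinnertonDyer-26471`
(`Summit.BirchSwinnertonDyer.BirchSwinnertonDyer.Theses.ThetaPartnerAtTwo.SignedMainConjectureCMTwoRankZeroOfPubOfFlat`,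
route `ThetaPartnerAtTwo`, line `rankzero` v16, lead prover bsd-wall-tp2-p2 g9, 2026-08-28). BSD is not proved
by any of this; nothing here mentions an elliptic curve over `ℚ`.

WHAT THIS FILE DOES. The typer file `Literature/…/EllipticUnits/KatoEllipticZetaElement.lean` (bsd-inputs-er2-ty1,
p616607 + p618607) pins Kato's `𝔥¹` of the tower `K(p^∞𝔣)` as `D : Kato2004.EllipticUnitTower K p 𝔣 ι` over the
abstract `Λ = D.Λ = ℤ_p[[G_{p^∞𝔣}]]`, and — for a prime `𝔮` of `Λ` of ANY height, `A := Λ_𝔮`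
(`Localization.AtPrime`) — identifies Kato's `A`-module `H¹_𝔮/A·z_{p^∞𝔣}` (p. 265) with
`(𝔥¹/ℨ)_𝔮 ≃ (𝔥¹)_𝔮 / A·((_𝔞z)_n/1)` (`nonempty_localized_quotient_Z_equiv`) and transports the K-tower EQUALITY
of Johnson-Leung–Kings 2011 (Thm. 5.7 at the regular height-one primes, §7.2; the sibling predicate
`ZetaSkeleton.Thm57RegularShape p` on `D.toZetaSkeleton`, NOT `Thm57Shape` — lead ruling R6) to the
height-one primes of `A` (`thm57RegularShape_lengthAt_atPrime_eq_of_not_mem`). Files 1–3 of this series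
(`…KatoDescentSnake/Devissage/KatoDescent`) PROVE Kato's Lemma 14.15 over `A` and the descent inequality
`ℓ_A(W/A·ι z) ≤ ℓ_A(M/aM)`. The theorem below is their COMPOSITION: clause (g) of the LOWER package,
`ℓ_𝔭(𝐇¹(T~)/Λ z_A) ≤ ℓ_𝔭(𝐇²(T~))`, with every K-side input consumed BY NAME and exactly the following
left as hypotheses (the debt of the recommended typer unit «CyclotomicTransport», Kato Lemma 15.13):
* 15.13 (1): `A = Λ_𝔮` (for `𝔮 = π⁻¹𝔭`) is a Noetherian local domain of dimension `≤ 2` (Kato: regular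
  local of dimension `2` after `⊗ O_λ`), `a ∈ 𝔪_A` generates `ker(A → O_λ⟦G_∞⟧_𝔭)`, and `(𝔥¹)_𝔮` has no
  `a`-torsion (§15.1: torsion free);
* (15.13.1): `M_𝔮/aM_𝔮 ≅ 𝐇²(T~)_𝔭` for `M = H²` — enters only through the reading of the right-hand side
  `ℓ_A(M_𝔮/aM_𝔮)` and through the support hypothesis `hMa` (`ℓ(𝐇²(T~)_𝔭) < ∞`, Kato Thm. 12.4 (1), via
  `lengthAt_eq_zero_of_length_quotSMulTop_ne_top`);
* (15.13.2): `ι : (𝔥¹)_𝔮 → W = 𝐇¹(T~)_𝔭` with `ker ι = a·(𝔥¹)_𝔮` and `ℓ_A(W/ι(𝔥¹)_𝔮) ≤ ℓ_A(M_𝔮[a])`;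
* Thm. 12.4 (2): `Ann_A(ι(z/1)) ⊆ (a)` (`𝐇¹(T~)` torsion free over the domain `A/aA`, `z~ ≠ 0`), and the
  support hypothesis `hNa` (`ℓ(𝐇¹(T~)_𝔭/z~) < ∞`);
* the `O_λ`-coefficients / `ψ`-twist of (15.12.1) (the typer's honest limit (T3); the statement below is
  over the untwisted `ℤ_p`-tower `D`, to which the twist is an isomorphism of the whole situation).

## References
* K. Kato, Astérisque 295 (2004), §15.1 (p. 251), Lemma 14.15 (p. 243–244), Lemma 15.13 and
  Prop. 15.17 (p. 264–265), Thm. 12.4 (p. 221).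
* J. Johnson-Leung, G. Kings, J. reine angew. Math. 653 (2011), Thm. 5.7, §7.2.
-/

set_option autoImplicit false
set_option linter.dupNamespace false

noncomputable section

open scoped Classical Pointwise NumberField

universe u

namespace Summit.BirchSwinnertonDyer.BirchSwinnertonDyer.Theorems.KatoDescent

open Literature.NumberTheory.EllipticCurves Literature.NumberTheory.EllipticCurves.Module
open Literature.NumberTheory.ComplexMultiplication.EllipticUnits
open Literature.NumberTheory.ComplexMultiplication.EllipticUnits.Kato2004

/-! ## Plumbing: torsion along localisation and along equivalences -/

section Plumbing

variable {R : Type*} [CommRing R]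

/-- Localisation of an (elementwise) torsion module is torsion: a non-zero-divisor of `R` stays one in `R_S`
(Mathlib `IsLocalization.nonZeroDivisors_le_comap`). [folklore] -/
theorem isTorsion_localizedModule' (S : Submonoid R) {M : Type*} [AddCommGroup M] [Module R M]
    (hM : Module.IsTorsion R M) :
    Module.IsTorsion (Localization S) (LocalizedModule S M) := by
  intro x
  induction x using LocalizedModule.induction_on with
  | h m s =>
    obtain ⟨⟨r, hr⟩, hrm⟩ := @hM m
    refine ⟨⟨algebraMap R (Localization S) r,
      IsLocalization.nonZeroDivisors_le_comap S (S := Localization S) hr⟩, ?_⟩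
    change algebraMap R (Localization S) r • LocalizedModule.mk m s = 0
    change r • m = 0 at hrm
    rw [algebraMap_smul, LocalizedModule.smul'_mk, hrm, LocalizedModule.zero_mk]

/-- Torsion is invariant under linear equivalences. [folklore] -/
theorem isTorsion_of_linearEquiv {M N : Type*} [AddCommGroup M] [Module R M] [AddCommGroup N]
    [Module R N] (e : M ≃ₗ[R] N) (hM : Module.IsTorsion R M) : Module.IsTorsion R N := by
  intro y
  obtain ⟨r, hr⟩ := @hM (e.symm y)
  refine ⟨r, ?_⟩
  rw [Submonoid.smul_def] at hr ⊢
  have : e ((r : R) • e.symm y) = 0 := by rw [hr, map_zero]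
  rwa [LinearEquiv.map_smul, LinearEquiv.apply_symm_apply] at this

end Plumbing

/-! ## Clause (g), K-side half, on `D : Kato2004.EllipticUnitTower K p 𝔣 ι` -/

section KSide

variable {K : Type} [Field K] [NumberField K] {p : ℕ} [Fact p.Prime] {𝔣 : Ideal (𝓞 K)} {ι₀ : K →+* ℂ}

/-- **Clause (g) of the LOWER package from the K-tower equality (JLK 2011 §7.2) through Kato's p. 265
descent — everything K-side BY NAME.** Data: the elliptic-unit tower `D` of `K(p^∞𝔣)` (typed interface), the
printed clause `hreg` (`N(𝔞) − σ_𝔞` non-zero-divisors), Kato's `𝔥²`-module `H2` (finitely generated torsion: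
§15.1 / JLK Thm. 5.7 (3)), the EQUALITY `Thm57RegularShape p` on `D.toZetaSkeleton` (Johnson-Leung–Kings
Thm. 5.7 at the regular height-one primes — unconditional, §7.2), the §15.1 review `Section151Shape`, a prime
`𝔮` of `Λ = D.Λ` with `p ∉ 𝔮` (Kato's `𝔮 = π⁻¹𝔭`, `𝔭 ∌ p`: Thm. 15.2 condition (a)) and an admissible twist `𝔞`
with `N(𝔞) − σ_𝔞 ∉ 𝔮` (so `A·z_{p^∞𝔣} = A·(_𝔞z)_n`, (15.6.4)); write `A = Λ_𝔮`, `H_𝔮 = (𝔥¹)_𝔮`,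
`z = (_𝔞z)_n/1 ∈ H_𝔮`, `M_𝔮 = (H2)_𝔮`. HYPOTHESES LEFT (the «CyclotomicTransport» debt, module docstring):
15.13 (1) as instances on `A` + `a ∈ 𝔪_A` + `H_𝔮[a] = 0`; the supports of `M_𝔮` and `H_𝔮/A z` off the
height-one primes `∋ a`; (15.13.2) as `ι`, `hker`, `hcoker`; 12.4 (2) as `hz`. CONCLUSION:
`ℓ_A(W/A·ι z) ≤ ℓ_A(M_𝔮/aM_𝔮)`, i.e. `ℓ_𝔭(𝐇¹(T~)/Λ z~) ≤ ℓ_𝔭(𝐇²(T~))` once `W = 𝐇¹(T~)_𝔭` and (15.13.1)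
`M_𝔮/aM_𝔮 ≅ 𝐇²(T~)_𝔭` are supplied. Proof: `length_quotient_span_le_length_quotSMulTop` (file 3) with
`hcmp` := the transported JLK equality (`thm57RegularShape_lengthAt_atPrime_eq_of_not_mem` along
`nonempty_localized_quotient_Z_equiv`), `hN` := `Section151Shape.isTorsion_localized_quotient_Z`, `hM` :=
localisation of the torsion module `H2`.
[cite: Kato2004Asterisque, proof of Prop. 15.17 (p. 265), Lemma 15.13 (p. 264), Lemma 14.15 (p. 243–244), Thm. 12.4 (p. 221), §15.1 (p. 251), (15.6.4) (p. 254)]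
[cite: JohnsonLeungKings2011, Thm. 5.7 and §7.2 (arXiv:0804.2828 p0021 L129 – p0022 L50)] -/
theorem length_quotient_span_ell_le_length_quotSMulTop
    (D : EllipticUnitTower K p 𝔣 ι₀)
    (hreg : ∀ 𝔞 : EllipticUnitTower.TwistIdeals K p 𝔣, IsSMulRegular D.Λ (D.nsub 𝔞.1))
    {H0 H2 : Type} [AddCommGroup H0] [Module D.Λ H0] [AddCommGroup H2] [Module D.Λ H2]
    [Module.Finite D.Λ H2] (hH2 : Module.IsTorsion D.Λ H2)
    (hK : (D.toZetaSkeleton hreg H0 H2).Thm57RegularShape p)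
    (h151 : D.Section151Shape)
    (𝔮 : PrimeSpectrum D.Λ) (hp : (p : D.Λ) ∉ 𝔮.asIdeal)
    {𝔞 : Ideal (𝓞 K)} (h𝔞 : IsTwist p 𝔣 𝔞) (hn : D.nsub 𝔞 ∉ 𝔮.asIdeal)
    -- Kato Lemma 15.13 (1), as hypotheses on `A = Λ_𝔮`
    [IsNoetherianRing (Localization.AtPrime 𝔮.asIdeal)] [IsDomain (Localization.AtPrime 𝔮.asIdeal)]
    [Ring.KrullDimLE 2 (Localization.AtPrime 𝔮.asIdeal)]
    {a : Localization.AtPrime 𝔮.asIdeal}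
    (ha : a ∈ IsLocalRing.maximalIdeal (Localization.AtPrime 𝔮.asIdeal))
    (hHa : tors a (LocalizedModule 𝔮.asIdeal.primeCompl D.H) = ⊥)
    -- supports off the height-one primes `∋ a` (Kato Thm. 12.4 (1)–(2) + Nakayama, file 3)
    (hMa : ∀ 𝔮' : PrimeSpectrum (Localization.AtPrime 𝔮.asIdeal), 𝔮'.asIdeal.height = 1 →
      a ∈ 𝔮'.asIdeal → lengthAt (Localization.AtPrime 𝔮.asIdeal)
        (LocalizedModule 𝔮.asIdeal.primeCompl H2) 𝔮' = 0)
    (hNa : ∀ 𝔮' : PrimeSpectrum (Localization.AtPrime 𝔮.asIdeal), 𝔮'.asIdeal.height = 1 →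
      a ∈ 𝔮'.asIdeal → lengthAt (Localization.AtPrime 𝔮.asIdeal)
        (LocalizedModule 𝔮.asIdeal.primeCompl D.H ⧸
          Submodule.span (Localization.AtPrime 𝔮.asIdeal)
            {LocalizedModule.mkLinearMap 𝔮.asIdeal.primeCompl D.H (D.ell 𝔞)}) 𝔮' = 0)
    -- (15.13.2) and Thm. 12.4 (2)
    {W : Type*} [AddCommGroup W] [Module (Localization.AtPrime 𝔮.asIdeal) W]
    (ι : LocalizedModule 𝔮.asIdeal.primeCompl D.H →ₗ[Localization.AtPrime 𝔮.asIdeal] W)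
    (hker : LinearMap.ker ι = a • (⊤ : Submodule (Localization.AtPrime 𝔮.asIdeal)
      (LocalizedModule 𝔮.asIdeal.primeCompl D.H)))
    (hcoker : Module.length (Localization.AtPrime 𝔮.asIdeal) (W ⧸ LinearMap.range ι) ≤
      Module.length (Localization.AtPrime 𝔮.asIdeal) (tors a (LocalizedModule 𝔮.asIdeal.primeCompl H2)))
    (hz : ∀ b : Localization.AtPrime 𝔮.asIdeal,
      b • ι (LocalizedModule.mkLinearMap 𝔮.asIdeal.primeCompl D.H (D.ell 𝔞)) = 0 → b ∈ Ideal.span {a}) :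
    Module.length (Localization.AtPrime 𝔮.asIdeal)
        (W ⧸ Submodule.span (Localization.AtPrime 𝔮.asIdeal)
          {ι (LocalizedModule.mkLinearMap 𝔮.asIdeal.primeCompl D.H (D.ell 𝔞))}) ≤
      Module.length (Localization.AtPrime 𝔮.asIdeal)
        (QuotSMulTop a (LocalizedModule 𝔮.asIdeal.primeCompl H2)) := by
  haveI : Module.Finite D.Λ D.H := h151.1
  obtain ⟨e⟩ := D.nonempty_localized_quotient_Z_equiv 𝔮 h𝔞 hn
  have hN : Module.IsTorsion (Localization.AtPrime 𝔮.asIdeal)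
      (LocalizedModule 𝔮.asIdeal.primeCompl D.H ⧸ Submodule.span (Localization.AtPrime 𝔮.asIdeal)
        {LocalizedModule.mkLinearMap 𝔮.asIdeal.primeCompl D.H (D.ell 𝔞)}) :=
    isTorsion_of_linearEquiv e (h151.isTorsion_localized_quotient_Z D 𝔮)
  have hM : Module.IsTorsion (Localization.AtPrime 𝔮.asIdeal)
      (LocalizedModule 𝔮.asIdeal.primeCompl H2) :=
    isTorsion_localizedModule' _ hH2
  have hcmp : ∀ 𝔮' : PrimeSpectrum (Localization.AtPrime 𝔮.asIdeal), 𝔮'.asIdeal.height = 1 →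
      a ∉ 𝔮'.asIdeal →
      lengthAt (Localization.AtPrime 𝔮.asIdeal)
          (LocalizedModule 𝔮.asIdeal.primeCompl D.H ⧸ Submodule.span (Localization.AtPrime 𝔮.asIdeal)
            {LocalizedModule.mkLinearMap 𝔮.asIdeal.primeCompl D.H (D.ell 𝔞)}) 𝔮' ≤
        lengthAt (Localization.AtPrime 𝔮.asIdeal) (LocalizedModule 𝔮.asIdeal.primeCompl H2) 𝔮' :=
    fun 𝔮' h1 _ ↦ by
      rw [← lengthAt_eq_of_linearEquiv e 𝔮',
        D.thm57RegularShape_lengthAt_atPrime_eq_of_not_mem hreg hK 𝔮 hp 𝔮' h1]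
  exact length_quotient_span_le_length_quotSMulTop ha hM hMa hHa _ hN hNa hcmp ι hker hcoker hz

/-- **The same with the TWO support hypotheses replaced by ONE finite length** (appended, lead g9): under the
JLK equality `Thm57RegularShape p` the supports of `(𝔥¹/ℨ)_𝔮` and `(𝔥²)_𝔮` agree at EVERY height-one prime of
`A = Λ_𝔮` (also at those containing `a`, `thm57RegularShape_lengthAt_atPrime_eq_of_not_mem`), so `hNa` follows
from `hMa`; and `hMa` follows (Nakayama, `lengthAt_eq_zero_of_length_quotSMulTop_ne_top`) from the finiteness of
`ℓ_A(M_𝔮/aM_𝔮)` — i.e. of `ℓ_𝔭(𝐇²(T~))` after (15.13.1), Kato Thm. 12.4 (1) — once `ht 𝔪_A ≠ 1` (Kato 15.13 (1):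
`A` has dimension `2`). Net typed debt of clause (g) on the K-side: 15.13 (1) (ring facts on `Λ_𝔮`, `a`,
`(𝔥¹)_𝔮[a] = 0`), (15.13.1) (finite length of `M_𝔮/aM_𝔮` and its reading), (15.13.2) (`ι`, `hker`, `hcoker`),
12.4 (2) (`hz`). [cite: Kato2004Asterisque, Lemma 15.13 (p. 264), proof of Prop. 15.17 (p. 265), Thm. 12.4 (p. 221)]
[cite: JohnsonLeungKings2011, Thm. 5.7 and §7.2] -/
theorem length_quotient_span_ell_le_length_quotSMulTop_of_length_ne_top
    (D : EllipticUnitTower K p 𝔣 ι₀)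
    (hreg : ∀ 𝔞 : EllipticUnitTower.TwistIdeals K p 𝔣, IsSMulRegular D.Λ (D.nsub 𝔞.1))
    {H0 H2 : Type} [AddCommGroup H0] [Module D.Λ H0] [AddCommGroup H2] [Module D.Λ H2]
    [Module.Finite D.Λ H2] (hH2 : Module.IsTorsion D.Λ H2)
    (hK : (D.toZetaSkeleton hreg H0 H2).Thm57RegularShape p)
    (h151 : D.Section151Shape)
    (𝔮 : PrimeSpectrum D.Λ) (hp : (p : D.Λ) ∉ 𝔮.asIdeal)
    {𝔞 : Ideal (𝓞 K)} (h𝔞 : IsTwist p 𝔣 𝔞) (hn : D.nsub 𝔞 ∉ 𝔮.asIdeal)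
    [IsNoetherianRing (Localization.AtPrime 𝔮.asIdeal)] [IsDomain (Localization.AtPrime 𝔮.asIdeal)]
    [Ring.KrullDimLE 2 (Localization.AtPrime 𝔮.asIdeal)]
    (h𝔪 : (IsLocalRing.maximalIdeal (Localization.AtPrime 𝔮.asIdeal)).height ≠ 1)
    {a : Localization.AtPrime 𝔮.asIdeal}
    (ha : a ∈ IsLocalRing.maximalIdeal (Localization.AtPrime 𝔮.asIdeal))
    (hHa : tors a (LocalizedModule 𝔮.asIdeal.primeCompl D.H) = ⊥)
    (hfinM : Module.length (Localization.AtPrime 𝔮.asIdeal)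
      (QuotSMulTop a (LocalizedModule 𝔮.asIdeal.primeCompl H2)) ≠ ⊤)
    {W : Type*} [AddCommGroup W] [Module (Localization.AtPrime 𝔮.asIdeal) W]
    (ι : LocalizedModule 𝔮.asIdeal.primeCompl D.H →ₗ[Localization.AtPrime 𝔮.asIdeal] W)
    (hker : LinearMap.ker ι = a • (⊤ : Submodule (Localization.AtPrime 𝔮.asIdeal)
      (LocalizedModule 𝔮.asIdeal.primeCompl D.H)))
    (hcoker : Module.length (Localization.AtPrime 𝔮.asIdeal) (W ⧸ LinearMap.range ι) ≤
      Module.length (Localization.AtPrime 𝔮.asIdeal) (tors a (LocalizedModule 𝔮.asIdeal.primeCompl H2)))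
    (hz : ∀ b : Localization.AtPrime 𝔮.asIdeal,
      b • ι (LocalizedModule.mkLinearMap 𝔮.asIdeal.primeCompl D.H (D.ell 𝔞)) = 0 → b ∈ Ideal.span {a}) :
    Module.length (Localization.AtPrime 𝔮.asIdeal)
        (W ⧸ Submodule.span (Localization.AtPrime 𝔮.asIdeal)
          {ι (LocalizedModule.mkLinearMap 𝔮.asIdeal.primeCompl D.H (D.ell 𝔞))}) ≤
      Module.length (Localization.AtPrime 𝔮.asIdeal)
        (QuotSMulTop a (LocalizedModule 𝔮.asIdeal.primeCompl H2)) := by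
  haveI : Module.Finite D.Λ D.H := h151.1
  have hMa : ∀ 𝔮' : PrimeSpectrum (Localization.AtPrime 𝔮.asIdeal), 𝔮'.asIdeal.height = 1 →
      a ∈ 𝔮'.asIdeal → lengthAt (Localization.AtPrime 𝔮.asIdeal)
        (LocalizedModule 𝔮.asIdeal.primeCompl H2) 𝔮' = 0 := fun 𝔮' h1 ha' ↦
    lengthAt_eq_zero_of_length_quotSMulTop_ne_top hfinM ha' (fun h ↦ h𝔪 (h ▸ h1))
  obtain ⟨e⟩ := D.nonempty_localized_quotient_Z_equiv 𝔮 h𝔞 hn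
  have hNa : ∀ 𝔮' : PrimeSpectrum (Localization.AtPrime 𝔮.asIdeal), 𝔮'.asIdeal.height = 1 →
      a ∈ 𝔮'.asIdeal → lengthAt (Localization.AtPrime 𝔮.asIdeal)
        (LocalizedModule 𝔮.asIdeal.primeCompl D.H ⧸
          Submodule.span (Localization.AtPrime 𝔮.asIdeal)
            {LocalizedModule.mkLinearMap 𝔮.asIdeal.primeCompl D.H (D.ell 𝔞)}) 𝔮' = 0 :=
    fun 𝔮' h1 ha' ↦ by
      rw [← lengthAt_eq_of_linearEquiv e 𝔮',
        D.thm57RegularShape_lengthAt_atPrime_eq_of_not_mem hreg hK 𝔮 hp 𝔮' h1]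
      exact hMa 𝔮' h1 ha'
  exact length_quotient_span_ell_le_length_quotSMulTop D hreg hH2 hK h151 𝔮 hp h𝔞 hn ha hHa hMa hNa
    ι hker hcoker hz

end KSide

end Summit.BirchSwinnertonDyer.BirchSwinnertonDyer.Theorems.KatoDescent

end
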